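import Literature.Probability.RandomPlanarGeometry.HexSAWIrreducibleWidthLaw
import Literature.Probability.RandomPlanarGeometry.HexSAWBridgeLogDecay
import HarnessLib

/-!
# The critical irreducible-bridge WIDTH law on the hexagonal lattice: Erickson sandwich and `(ln T)^{1/3}` mean growth

Topic `Literature/Probability/RandomPlanarGeometry` (continues `HexSAWIrreducibleWidthLaw.lean` — the objects
`HV.irrTail T = r_T = P(width > T)`, `HV.bridgeMass T = U_T = Σ_{t≤T} B_t(x_c)`, the last-renewal identity
`HV.sum_bridge_mul_irrTail_eq_one` (`Σ_{n≤N} u_n r_{N−n} = 1`, `u_0 = 1`, `u_n = B_n(x_c)`), the Chebyshev lower half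
`HV.succ_le_one_add_bridgeMass_mul_sum_irrTail`, `HV.HexIrrMeanBound_holds` — and `HexSAWBridgeLogDecay.lean` —
`hexBridgeLogDecay : HexBridgeLogDecay 5 2`, i.e. `B_T(x_c) ≤ 5 (ln T)^{-1/3}` for `T ≥ 2`).

1. **The Erickson sandwich** (lane «pcv-sawmu», route R53 (e); planner a-idea-1 `Sketch_G11` §R53, statement
   `HexEricksonSandwich` verbatim): for EVERY `T`,
   `T + 1 ≤ (1 + U_T) · m_T ≤ 2(T + 1)`, `m_T = Σ_{j≤T} r_j = E[min(width, T+1)]` — the discrete form of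
   Erickson's Lemma 1 (`t/m(t) ≤ U(t) ≤ 2t/m(t)` for infinite-mean renewal processes) for the Kesten /
   Duminil-Copin–Smirnov width renewal of critical hexagonal-lattice bridges. Upper half: sum the last-renewal identity
   over `N ≤ 2T` and keep the terms `n ≤ T`, whose inner sums dominate `m_T`.
2. **`(ln T)^{1/3}` growth of the truncated mean width** (route R53 (c) = R53 (b) ∘ R57, statement
   `stub_R53_C5_logmean` verbatim): a logarithmic bridge decay `B_T(x_c) ≤ C (ln T)^{-1/3}` (`T ≥ T₀`) and the mean
   bound `m_T ≥ (T+1)/(1+U_T)` give `m_T ≥ c (ln T)^{1/3}` for all `T ≥ 2` (`U_T ≤ T₀ + 3 + √T + 2C·T (ln T)^{-1/3}`,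
   splitting at `√T`); unconditionally with the tree's `(C, T₀) = (5, 2)`.

[cite: Erickson1973, Lemma 1]; [cite: MadrasSlade1993, Appendix B, eq. (B.5)]; [cite: GlazmanManolescu2019, Proposition 1.1].
Seat a-p1 gen 5, 2026-08-22.
-/

noncomputable section

open Finset Filter Topology

namespace Literature.Probability.RandomPlanarGeometry.SAW

namespace HV

/-! ### (e) The Erickson sandwich -/

/-- The ERICKSON SANDWICH for critical hex bridges: with `U_T = Σ_{t≤T} B_t(x_c)` and the truncated mean
`m_T = Σ_{j≤T} r_j = E[min(height, T+1)]` of the Kesten-irreducible height, `T+1 ≤ (1+U_T)·m_T ≤ 2(T+1)` for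
EVERY `T` (planner statement, verbatim). [cite: Erickson1973, Lemma 1] -/
def HexEricksonSandwich : Prop := ∀ T : ℕ,
  (T : ℝ) + 1 ≤ (1 + bridgeMass T) * ∑ j ∈ range (T + 1), irrTail j ∧
    (1 + bridgeMass T) * ∑ j ∈ range (T + 1), irrTail j ≤ 2 * ((T : ℝ) + 1)

/-- The renewal weights `u_0 = 1`, `u_n = B_n(x_c)` are nonnegative. [cite: DuminilCopinSmirnov2012, §3] -/
private theorem u_nonneg (n : ℕ) : 0 ≤ (if n = 0 then (1 : ℝ) else stripBlim n) := by
  split_ifs with h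
  · norm_num
  · exact stripBlim_nonneg (by omega)

/-- `1 + U_T = Σ_{n ≤ T} u_n`. [cite: DuminilCopinSmirnov2012, §3] -/
theorem one_add_bridgeMass_eq_sum (T : ℕ) :
    1 + bridgeMass T = ∑ n ∈ range (T + 1), (if n = 0 then (1 : ℝ) else stripBlim n) := by
  induction T with
  | zero => simp [bridgeMass]
  | succ T ih =>
    rw [sum_range_succ, ← ih, bridgeMass, bridgeMass, sum_Icc_succ_top (by omega), if_neg (by omega)]
    ring

/-- **Upper half of the Erickson sandwich**: `(1 + U_T) · m_T ≤ 2T + 1` — sum the last-renewal identity over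
`N ≤ 2T` (total `2T+1`), swap the sums, and keep the terms `n ≤ T`, each of whose inner sums `Σ_{k ≤ 2T−n} r_k`
dominates `m_T`. [cite: Erickson1973, Lemma 1] -/
theorem one_add_bridgeMass_mul_sum_irrTail_le (T : ℕ) :
    (1 + bridgeMass T) * ∑ j ∈ range (T + 1), irrTail j ≤ 2 * (T : ℝ) + 1 := by
  set u : ℕ → ℝ := fun n => if n = 0 then (1 : ℝ) else stripBlim n with hu
  have htot : ∑ N ∈ range (2 * T + 1), ∑ n ∈ range (N + 1), u n * irrTail (N - n) = 2 * (T : ℝ) + 1 := by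
    rw [sum_congr rfl fun N _ => sum_bridge_mul_irrTail_eq_one N]
    simp
  rw [show (∑ N ∈ range (2 * T + 1), ∑ n ∈ range (N + 1), u n * irrTail (N - n)) =
      ∑ n ∈ range (2 * T + 1), ∑ k ∈ range (2 * T + 1 - n), u n * irrTail k from
    sum_range_diag_flip (2 * T + 1) (fun k j => u k * irrTail j)] at htot
  rw [← htot, one_add_bridgeMass_eq_sum, sum_mul]
  have hr0 : ∀ k, 0 ≤ irrTail k := irrTail_nonneg
  have hsubT : range (T + 1) ⊆ range (2 * T + 1) := Finset.range_mono (by omega : T + 1 ≤ 2 * T + 1)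
  calc ∑ n ∈ range (T + 1), u n * ∑ j ∈ range (T + 1), irrTail j
      ≤ ∑ n ∈ range (T + 1), u n * ∑ k ∈ range (2 * T + 1 - n), irrTail k := by
        refine sum_le_sum fun n hn => mul_le_mul_of_nonneg_left ?_ (u_nonneg n)
        rw [mem_range] at hn
        have hsub : range (T + 1) ⊆ range (2 * T + 1 - n) := Finset.range_mono (by omega : T + 1 ≤ 2 * T + 1 - n)
        exact sum_le_sum_of_subset_of_nonneg hsub fun k _ _ => hr0 k
    _ ≤ ∑ n ∈ range (2 * T + 1), u n * ∑ k ∈ range (2 * T + 1 - n), irrTail k :=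
        sum_le_sum_of_subset_of_nonneg hsubT fun n _ _ =>
          mul_nonneg (u_nonneg n) (sum_nonneg fun k _ => hr0 k)
    _ = ∑ n ∈ range (2 * T + 1), ∑ k ∈ range (2 * T + 1 - n), u n * irrTail k :=
        sum_congr rfl fun n _ => mul_sum _ _ _

/-- **The Erickson sandwich holds** (route R53 (e)): `T + 1 ≤ (1 + U_T) m_T ≤ 2(T + 1)` for every `T`.
[cite: Erickson1973, Lemma 1] -/
theorem hexEricksonSandwich : HexEricksonSandwich := fun T =>
  ⟨succ_le_one_add_bridgeMass_mul_sum_irrTail T, (one_add_bridgeMass_mul_sum_irrTail_le T).trans (by linarith)⟩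

/-! ### (c) `(ln T)^{1/3}` growth of the truncated mean width -/

/-- `(ln T)^{1/3} ≤ √T` for `T ≥ 1` (from `ln T ≤ T − 1 ≤ T^{3/2}`). [folklore] -/
private theorem log_rpow_third_le_sqrt {T : ℝ} (hT : 1 ≤ T) :
    (Real.log T) ^ ((1 : ℝ) / 3) ≤ Real.sqrt T := by
  have hT0 : 0 < T := by linarith
  have hlog0 : 0 ≤ Real.log T := Real.log_nonneg hT
  have h1 : Real.log T ≤ T ^ ((3 : ℝ) / 2) := by
    have hl : Real.log T ≤ T := (Real.log_le_sub_one_of_pos hT0).trans (by linarith)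
    refine hl.trans ?_
    calc T = T ^ (1 : ℝ) := (Real.rpow_one T).symm
      _ ≤ T ^ ((3 : ℝ) / 2) := Real.rpow_le_rpow_of_exponent_le hT (by norm_num)
  calc (Real.log T) ^ ((1 : ℝ) / 3) ≤ (T ^ ((3 : ℝ) / 2)) ^ ((1 : ℝ) / 3) :=
        Real.rpow_le_rpow hlog0 h1 (by norm_num)
    _ = Real.sqrt T := by
        rw [← Real.rpow_mul hT0.le, show (3 : ℝ) / 2 * (1 / 3) = 1 / 2 by norm_num, Real.sqrt_eq_rpow]

/-- For `t ≥ √T`, `T ≥ 2`, `t ≥ 2`: `(ln t)^{-1/3} ≤ 2 (ln T)^{-1/3}`. [folklore] -/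
private theorem log_rpow_neg_third_le {T t : ℝ} (hT : 2 ≤ T) (ht : Real.sqrt T ≤ t) :
    (Real.log t) ^ (-(1 : ℝ) / 3) ≤ 2 * (Real.log T) ^ (-(1 : ℝ) / 3) := by
  have hT0 : 0 < T := by linarith
  have hlogT : 0 < Real.log T := Real.log_pos (by linarith)
  have hsqrt1 : 1 < Real.sqrt T := by
    rw [show (1 : ℝ) = Real.sqrt 1 by simp]
    exact Real.sqrt_lt_sqrt (by norm_num) (by linarith)
  have ht0 : 0 < t := by linarith
  have hlog_half : Real.log T / 2 ≤ Real.log t := by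
    rw [← Real.log_sqrt hT0.le]
    exact Real.log_le_log (by linarith) ht
  have hhalf0 : 0 < Real.log T / 2 := by linarith
  have hexp : (-(1 : ℝ) / 3) ≤ 0 := by norm_num
  calc (Real.log t) ^ (-(1 : ℝ) / 3) ≤ (Real.log T / 2) ^ (-(1 : ℝ) / 3) :=
        Real.rpow_le_rpow_of_nonpos hhalf0 hlog_half hexp
    _ = (Real.log T) ^ (-(1 : ℝ) / 3) * (2 : ℝ) ^ ((1 : ℝ) / 3) := by
        rw [Real.div_rpow hlogT.le (by norm_num), show (-(1 : ℝ) / 3) = -((1 : ℝ) / 3) by ring,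
          Real.rpow_neg (by norm_num : (0 : ℝ) ≤ 2), div_inv_eq_mul]
    _ ≤ (Real.log T) ^ (-(1 : ℝ) / 3) * 2 := by
        refine mul_le_mul_of_nonneg_left ?_ (Real.rpow_nonneg hlogT.le _)
        calc (2 : ℝ) ^ ((1 : ℝ) / 3) ≤ (2 : ℝ) ^ (1 : ℝ) := Real.rpow_le_rpow_of_exponent_le (by norm_num) (by norm_num)
          _ = 2 := Real.rpow_one 2
    _ = 2 * (Real.log T) ^ (-(1 : ℝ) / 3) := by ring

/-- The bridge mass under a logarithmic decay: `U_T ≤ (T₀ + 3 + √T) + 2C·T·(ln T)^{-1/3}` for `T ≥ 2`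
(terms below the threshold `T₀ + ⌈√T⌉ + 2` bounded by `B_t ≤ 1`, the others by the decay at `t ≥ √T`).
[cite: GlazmanManolescu2019, Proposition 1.1] -/
theorem bridgeMass_le_of_logDecay {C : ℝ} {T₀ : ℕ} (hC : 0 ≤ C) (hB : HexBridgeLogDecay C T₀) {T : ℕ}
    (hT : 2 ≤ T) :
    bridgeMass T ≤ ((T₀ : ℝ) + 3 + Real.sqrt T) + 2 * C * T * (Real.log T) ^ (-(1 : ℝ) / 3) := by
  have hT2 : (2 : ℝ) ≤ T := by exact_mod_cast hT
  have hlogT : 0 < Real.log (T : ℝ) := Real.log_pos (by linarith)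
  set D : ℝ := (Real.log (T : ℝ)) ^ (-(1 : ℝ) / 3) with hD
  have hD0 : 0 ≤ D := Real.rpow_nonneg hlogT.le _
  set N₀ : ℕ := T₀ + ⌈Real.sqrt T⌉₊ + 2 with hN₀
  have hN₀real : (N₀ : ℝ) ≤ (T₀ : ℝ) + 3 + Real.sqrt T := by
    have := Nat.ceil_lt_add_one (Real.sqrt_nonneg (T : ℝ))
    rw [hN₀]; push_cast; linarith
  -- termwise bound
  have hterm : ∀ t ∈ Icc 1 T, stripBlim t ≤ (if t < N₀ then (1 : ℝ) else 0) + 2 * C * D := by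
    intro t ht
    rw [mem_Icc] at ht
    split_ifs with h
    · have := stripBlim_le_one ht.1
      nlinarith
    · rw [not_lt] at h
      have htT₀ : T₀ ≤ t := by omega
      have ht2 : (2 : ℝ) ≤ t := by exact_mod_cast (by omega : 2 ≤ t)
      have hsqrt : Real.sqrt T ≤ t := by
        have h1 : Real.sqrt T ≤ ⌈Real.sqrt (T : ℝ)⌉₊ := Nat.le_ceil _
        have h2 : (⌈Real.sqrt (T : ℝ)⌉₊ : ℝ) ≤ t := by exact_mod_cast (by omega : ⌈Real.sqrt (T : ℝ)⌉₊ ≤ t)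
        linarith
      have hdec := hB t htT₀
      have hlt := log_rpow_neg_third_le hT2 hsqrt
      calc stripBlim t ≤ C * (Real.log t) ^ (-(1 : ℝ) / 3) := hdec
        _ ≤ C * (2 * D) := mul_le_mul_of_nonneg_left hlt hC
        _ = 0 + 2 * C * D := by ring
  calc bridgeMass T = ∑ t ∈ Icc 1 T, stripBlim t := rfl
    _ ≤ ∑ t ∈ Icc 1 T, ((if t < N₀ then (1 : ℝ) else 0) + 2 * C * D) := sum_le_sum hterm
    _ = (∑ t ∈ Icc 1 T, if t < N₀ then (1 : ℝ) else 0) + T * (2 * C * D) := by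
        rw [sum_add_distrib, sum_const, Nat.card_Icc, nsmul_eq_mul]
        push_cast
        ring
    _ ≤ (N₀ : ℝ) + T * (2 * C * D) := by
        refine add_le_add ?_ le_rfl
        rw [← sum_filter]
        calc ∑ t ∈ (Icc 1 T).filter (fun t => t < N₀), (1 : ℝ) = ((Icc 1 T).filter (fun t => t < N₀)).card := by
              simp
          _ ≤ (range N₀).card := by
              exact_mod_cast card_le_card fun t ht => by
                rw [mem_filter] at ht; exact mem_range.2 ht.2
          _ = N₀ := by rw [card_range]
    _ ≤ ((T₀ : ℝ) + 3 + Real.sqrt T) + 2 * C * T * D := by nlinarith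

/-- **`(ln T)^{1/3}` growth of the truncated mean width** (route R53 (c) = R53 (b) ∘ R57; planner statement
`stub_R53_C5_logmean` verbatim): a logarithmic bridge decay and the mean bound give
`m_T = Σ_{j≤T} r_j ≥ c (ln T)^{1/3}` for all `T ≥ 2`, with `c = 1/(T₀ + 5 + 2C)`.
[cite: Erickson1973, Lemma 1]; [cite: GlazmanManolescu2019, Proposition 1.1] -/
theorem sum_irrTail_ge_log_of_logDecay {C : ℝ} {T₀ : ℕ} (hC : 0 < C) (hB : HexBridgeLogDecay C T₀)
    (hmean : HexIrrMeanBound) :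
    ∃ c : ℝ, 0 < c ∧ ∀ T : ℕ, 2 ≤ T → c * (Real.log T) ^ ((1 : ℝ) / 3) ≤ ∑ j ∈ range (T + 1), irrTail j := by
  set K : ℝ := (T₀ : ℝ) + 5 + 2 * C with hK
  have hK0 : 0 < K := by rw [hK]; positivity
  refine ⟨K⁻¹, inv_pos.2 hK0, fun T hT => ?_⟩
  have hT2 : (2 : ℝ) ≤ T := by exact_mod_cast hT
  have hT0 : (0 : ℝ) < T := by linarith
  have hlogT : 0 < Real.log (T : ℝ) := Real.log_pos (by linarith)
  set D : ℝ := (Real.log (T : ℝ)) ^ (-(1 : ℝ) / 3) with hD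
  have hD0 : 0 < D := Real.rpow_pos_of_pos hlogT _
  have hDinv : D⁻¹ = (Real.log (T : ℝ)) ^ ((1 : ℝ) / 3) := by
    rw [hD, show (-(1 : ℝ) / 3) = -((1 : ℝ) / 3) by ring, Real.rpow_neg hlogT.le, inv_inv]
  -- `D T ≥ √T ≥ 1`
  have hsqrtT : Real.sqrt T ≤ D * T := by
    have h1 := log_rpow_third_le_sqrt (T := (T : ℝ)) (by linarith)
    have hs0 : 0 < Real.sqrt (T : ℝ) := Real.sqrt_pos.2 hT0
    -- √T = T / √T ≤ T / (ln T)^{1/3} = D T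
    have h2 : Real.sqrt (T : ℝ) * Real.sqrt T = T := Real.mul_self_sqrt hT0.le
    rw [← hDinv] at h1
    -- D⁻¹ ≤ √T  ⇒  √T = T/√T ≤ T·D
    have h3 : Real.sqrt (T : ℝ) * D⁻¹ ≤ T := by nlinarith
    calc Real.sqrt (T : ℝ) = Real.sqrt T * D⁻¹ * D := by field_simp
      _ ≤ T * D := mul_le_mul_of_nonneg_right h3 hD0.le
      _ = D * T := mul_comm _ _
  have hone : (1 : ℝ) ≤ D * T := by
    have : (1 : ℝ) ≤ Real.sqrt T := by
      rw [show (1 : ℝ) = Real.sqrt 1 by simp]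
      exact Real.sqrt_le_sqrt (by linarith)
    linarith
  -- `1 + U_T ≤ K D T`
  have hU := bridgeMass_le_of_logDecay hC.le hB hT
  rw [← hD] at hU
  have hden : 1 + bridgeMass T ≤ K * (D * T) := by
    have hT₀0 : (0 : ℝ) ≤ T₀ := Nat.cast_nonneg _
    calc 1 + bridgeMass T ≤ 1 + (((T₀ : ℝ) + 3 + Real.sqrt T) + 2 * C * T * D) := by linarith
      _ ≤ (D * T) + (((T₀ : ℝ) + 3) * (D * T) + D * T + 2 * C * (D * T)) := by nlinarith
      _ = K * (D * T) := by rw [hK]; ring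
  have hdenpos : 0 < 1 + bridgeMass T := by linarith [bridgeMass_nonneg T]
  have hm := hmean T (by omega)
  -- `K⁻¹ (ln T)^{1/3} = T/(K D T) ≤ (T+1)/(1+U_T) ≤ m_T`
  calc K⁻¹ * (Real.log (T : ℝ)) ^ ((1 : ℝ) / 3) = T / (K * (D * T)) := by
        rw [← hDinv]; field_simp
    _ ≤ ((T : ℝ) + 1) / (1 + bridgeMass T) := by
        rw [div_le_div_iff₀ (by positivity) hdenpos]
        nlinarith
    _ ≤ ∑ j ∈ range (T + 1), irrTail j := hm

/-- **Unconditionally** (the tree's `hexBridgeLogDecay : HexBridgeLogDecay 5 2` and `HexIrrMeanBound_holds`):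
the truncated mean of the critical irreducible-bridge width on the hexagonal lattice grows at least like
`(ln T)^{1/3}` — an explicit QUANTITATIVE null recurrence of Kesten's width renewal.
[cite: Erickson1973, Lemma 1]; [cite: GlazmanManolescu2019, Proposition 1.1] -/
theorem sum_irrTail_ge_log :
    ∃ c : ℝ, 0 < c ∧ ∀ T : ℕ, 2 ≤ T → c * (Real.log T) ^ ((1 : ℝ) / 3) ≤ ∑ j ∈ range (T + 1), irrTail j :=
  sum_irrTail_ge_log_of_logDecay (by norm_num) hexBridgeLogDecay HexIrrMeanBound_holds

/-- A `(ln T)^{1/3}` lower bound makes the truncated mean width DIVERGE (planner statement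
`stub_R53_C6_infiniteMean` verbatim). [cite: Erickson1973, Lemma 1] -/
theorem tendsto_sum_irrTail_atTop_of
    (hc : ∃ c : ℝ, 0 < c ∧ ∀ T : ℕ, 2 ≤ T → c * (Real.log T) ^ ((1 : ℝ) / 3) ≤ ∑ j ∈ range (T + 1), irrTail j) :
    Tendsto (fun T : ℕ => ∑ j ∈ range (T + 1), irrTail j) atTop atTop := by
  obtain ⟨c, hc, h⟩ := hc
  have h1 : Tendsto (fun T : ℕ => c * (Real.log T) ^ ((1 : ℝ) / 3)) atTop atTop := by
    refine Tendsto.const_mul_atTop hc ?_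
    refine (tendsto_rpow_atTop (by norm_num : (0 : ℝ) < 1 / 3)).comp ?_
    exact Real.tendsto_log_atTop.comp tendsto_natCast_atTop_atTop
  exact tendsto_atTop_mono' atTop (by filter_upwards [eventually_ge_atTop 2] with T hT using h T hT) h1

/-- **The width of a Kesten-irreducible critical bridge of the hexagonal lattice has INFINITE MEAN**
(`E[min(width, T+1)] → ∞`, null recurrence of the width renewal), unconditionally, with the explicit
`(ln T)^{1/3}` rate of `sum_irrTail_ge_log`. [cite: Erickson1973, Lemma 1]; [cite: GlazmanManolescu2019, Proposition 1.1] -/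
theorem tendsto_sum_irrTail_atTop :
    Tendsto (fun T : ℕ => ∑ j ∈ range (T + 1), irrTail j) atTop atTop :=
  tendsto_sum_irrTail_atTop_of sum_irrTail_ge_log

/-! ### (c′) The constant made explicit -/

/-- **`(ln T)^{1/3}` growth with the constant exposed** (planner `stub_R53_C5_logmean_closed`, verbatim):
`m_T ≥ (ln T)^{1/3}/(T₀ + 5 + 2C)` for all `T ≥ 2` under `B_t(x_c) ≤ C (ln t)^{-1/3}` (`t ≥ T₀`) and the mean bound.
[cite: Erickson1973, Lemma 1]; [cite: GlazmanManolescu2019, Proposition 1.1] -/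
theorem sum_irrTail_ge_log_closed {C : ℝ} {T₀ : ℕ} (hC : 0 < C) (hB : HexBridgeLogDecay C T₀)
    (hmean : HexIrrMeanBound) (T : ℕ) (hT : 2 ≤ T) :
    ((T₀ : ℝ) + 5 + 2 * C)⁻¹ * (Real.log T) ^ ((1 : ℝ) / 3) ≤ ∑ j ∈ range (T + 1), irrTail j := by
  set K : ℝ := (T₀ : ℝ) + 5 + 2 * C with hK
  have hK0 : 0 < K := by rw [hK]; positivity
  have hT2 : (2 : ℝ) ≤ T := by exact_mod_cast hT
  have hT0 : (0 : ℝ) < T := by linarith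
  have hlogT : 0 < Real.log (T : ℝ) := Real.log_pos (by linarith)
  set D : ℝ := (Real.log (T : ℝ)) ^ (-(1 : ℝ) / 3) with hD
  have hD0 : 0 < D := Real.rpow_pos_of_pos hlogT _
  have hDinv : D⁻¹ = (Real.log (T : ℝ)) ^ ((1 : ℝ) / 3) := by
    rw [hD, show (-(1 : ℝ) / 3) = -((1 : ℝ) / 3) by ring, Real.rpow_neg hlogT.le, inv_inv]
  have hsqrtT : Real.sqrt T ≤ D * T := by
    have h1 := log_rpow_third_le_sqrt (T := (T : ℝ)) (by linarith)
    have hs0 : 0 < Real.sqrt (T : ℝ) := Real.sqrt_pos.2 hT0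
    have h2 : Real.sqrt (T : ℝ) * Real.sqrt T = T := Real.mul_self_sqrt hT0.le
    rw [← hDinv] at h1
    have h3 : Real.sqrt (T : ℝ) * D⁻¹ ≤ T := by nlinarith
    calc Real.sqrt (T : ℝ) = Real.sqrt T * D⁻¹ * D := by field_simp
      _ ≤ T * D := mul_le_mul_of_nonneg_right h3 hD0.le
      _ = D * T := mul_comm _ _
  have hone : (1 : ℝ) ≤ D * T := by
    have : (1 : ℝ) ≤ Real.sqrt T := by
      rw [show (1 : ℝ) = Real.sqrt 1 by simp]
      exact Real.sqrt_le_sqrt (by linarith)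
    linarith
  have hU := bridgeMass_le_of_logDecay hC.le hB hT
  rw [← hD] at hU
  have hden : 1 + bridgeMass T ≤ K * (D * T) := by
    have hT₀0 : (0 : ℝ) ≤ T₀ := Nat.cast_nonneg _
    calc 1 + bridgeMass T ≤ 1 + (((T₀ : ℝ) + 3 + Real.sqrt T) + 2 * C * T * D) := by linarith
      _ ≤ (D * T) + (((T₀ : ℝ) + 3) * (D * T) + D * T + 2 * C * (D * T)) := by nlinarith
      _ = K * (D * T) := by rw [hK]; ring
  have hdenpos : 0 < 1 + bridgeMass T := by linarith [bridgeMass_nonneg T]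
  have hm := hmean T (by omega)
  calc K⁻¹ * (Real.log (T : ℝ)) ^ ((1 : ℝ) / 3) = T / (K * (D * T)) := by
        rw [← hDinv]; field_simp
    _ ≤ ((T : ℝ) + 1) / (1 + bridgeMass T) := by
        rw [div_le_div_iff₀ (by positivity) hdenpos]
        nlinarith
    _ ≤ ∑ j ∈ range (T + 1), irrTail j := hm

/-- **`m_T ≥ (ln T)^{1/3}/17` for all `T ≥ 2`** (numeral form with the tree's `(C, T₀) = (5, 2)`; the content is the
`(ln T)^{1/3}` law — the numeral bound beats the trivial `m_T ≥ 1` only for `ln T > 17³`).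
[cite: Erickson1973, Lemma 1]; [cite: GlazmanManolescu2019, Proposition 1.1] -/
theorem sum_irrTail_ge_log_div_seventeen (T : ℕ) (hT : 2 ≤ T) :
    (17 : ℝ)⁻¹ * (Real.log T) ^ ((1 : ℝ) / 3) ≤ ∑ j ∈ range (T + 1), irrTail j := by
  have h := sum_irrTail_ge_log_closed (by norm_num) hexBridgeLogDecay HexIrrMeanBound_holds T hT
  have e : ((2 : ℕ) : ℝ) + 5 + 2 * 5 = 17 := by norm_num
  rw [e] at h
  exact h

/-- Alias of `hexEricksonSandwich` in the tree's `X_holds : X` convention (asked by lit-1, 2026-08-22).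
[cite: Erickson1973, Lemma 1] -/
theorem HexEricksonSandwich_holds : HexEricksonSandwich := hexEricksonSandwich

end HV

end Literature.Probability.RandomPlanarGeometry.SAW

end
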